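import Literature.NumberTheory.LFunctions.KloostermanFractionsOffDiagPhase
import Literature.NumberTheory.LFunctions.KloostermanFractionsOffDiagSet
import HarnessLib

/-!
# Bilinear forms with Kloosterman fractions: Weil's bound for the `n₂`-sum of a pair

Bettin–Chandee, *Trilinear forms with Kloosterman fractions* (arXiv:1502.00769), §4.1.3, in the
simplified setting of this series (amplifier `A = 1`, `𝔭ᵢ = 𝔮ᵢ = η = 1`, the prime `ℓ₂` kept
outside the Cauchy–Schwarz inequality, so that both members of a pair share `ℓ₂`).

After the complementary-divisor switch (`KloostermanFractionsComplementaryDivisor`), the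
Cauchy–Schwarz inequality (`KloostermanFractionsOffDiagCS`) and the reciprocity computation of
the combined phase (`KloostermanFractionsOffDiagPhase`, `kfw_pair_final`), the `n₂`-sum of a
pair `((ℓ₁,d),(ℓ₁',d'))` is an incomplete Kloosterman sum to the modulus `S = ℓ₁ℓ₁'n₁`,
restricted to an interval, to a residue class modulo `b·lcm(|d|,|d'|)`, to `(n₂, Sℓ₂) = 1`, and
twisted by `e(-kY/(bSn₂))`.  The twist is removed by partial summation (`kfw_abel_bound`,
`kfw_twist_variation`), and the Kloosterman sum is bounded by `KI_sum_interval_progression_le`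
(Weil's bound with the `(q, S) > 1` refinement).  The frequency `a` satisfies
`a·u ≡ kΔ' (mod n₁)` with `u` a unit, whence `(a, n₁) = (Δ', n₁)`,
`Δ' = (dℓ₁' - d'ℓ₁)ℓ₂ - (d - d')ℓ₁ℓ₁'` (B–C's `Δ`, up to the harmless factor `ℓ₂`).

Main result: `kfw_pair_sum_le`.

## References
* S. Bettin, V. Chandee, *Trilinear forms with Kloosterman fractions*, Adv. Math. 328 (2018),
  arXiv:1502.00769, §4.1.3, (gwp)–(boudn). [cite: BettinChandee2018, §4.1.3]
* W. Duke, J. Friedlander, H. Iwaniec, *Bilinear forms with Kloosterman fractions*,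
  Invent. Math. 128 (1997) 23–43, §4. [cite: DukeFriedlanderIwaniec1997, §4]
-/

noncomputable section

open Finset

namespace Literature.NumberTheory.LFunctions

/-! ### Arithmetic of the combined frequency `a` -/

/-- `τ(s₂) ≤ τ(S)` for `s₂ ∣ S ≠ 0`. [folklore] -/
theorem kfw_card_divisors_le_of_dvd {s₂ S : ℕ} (hS : S ≠ 0) (h : s₂ ∣ S) :
    s₂.divisors.card ≤ S.divisors.card :=
  Finset.card_le_card (Nat.divisors_subset_of_dvd hS h)

/-- Congruent integers have the same gcd with the modulus. [folklore] -/
theorem kfw_gcd_eq_of_modEq {n : ℕ} {x y : ℤ} (h : x ≡ y [ZMOD n]) : Int.gcd x n = Int.gcd y n := by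
  obtain ⟨t, ht⟩ := Int.modEq_iff_dvd.mp h
  -- `y = x + n t`
  have hy : y = x + n * t := by linarith
  apply Nat.dvd_antisymm
  · rw [Int.gcd_eq_natAbs, Int.gcd_eq_natAbs, Int.natAbs_natCast]
    refine Nat.dvd_gcd ?_ (Nat.gcd_dvd_right _ _)
    have h1 : (Int.gcd x n : ℤ) ∣ y := by
      rw [hy]
      exact dvd_add (Int.gcd_dvd_left _ _) ((Int.gcd_dvd_right _ _).mul_right t)
    have := Int.natAbs_dvd_natAbs.mpr h1
    simpa [Int.gcd_eq_natAbs] using this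
  · rw [Int.gcd_eq_natAbs, Int.gcd_eq_natAbs, Int.natAbs_natCast]
    refine Nat.dvd_gcd ?_ (Nat.gcd_dvd_right _ _)
    have h1 : (Int.gcd y n : ℤ) ∣ x := by
      have : x = y - n * t := by linarith
      rw [this]
      exact dvd_sub (Int.gcd_dvd_left _ _) ((Int.gcd_dvd_right _ _).mul_right t)
    have := Int.natAbs_dvd_natAbs.mpr h1
    simpa [Int.gcd_eq_natAbs] using this

/-- `(a, n₁) = (Δ', n₁)` when `a u ≡ k Δ' (mod n₁)` with `u, k` coprime to `n₁`. [folklore] -/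
theorem kfw_gcd_freq_eq {n₁ : ℕ} {a u kk Δ : ℤ} (h : a * u ≡ kk * Δ [ZMOD n₁])
    (hu : Int.gcd u n₁ = 1) (hk : Int.gcd kk n₁ = 1) : Int.gcd a n₁ = Int.gcd Δ n₁ := by
  have h1 : Int.gcd (a * u) n₁ = Int.gcd a n₁ := by
    rw [Int.gcd_eq_natAbs, Int.gcd_eq_natAbs, Int.natAbs_mul, Int.natAbs_natCast]
    rw [Int.gcd_eq_natAbs, Int.natAbs_natCast] at hu
    exact Nat.Coprime.gcd_mul_right_cancel _ hu
  have h2 : Int.gcd (kk * Δ) n₁ = Int.gcd Δ n₁ := by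
    rw [Int.gcd_eq_natAbs, Int.gcd_eq_natAbs, Int.natAbs_mul, Int.natAbs_natCast]
    rw [Int.gcd_eq_natAbs, Int.natAbs_natCast] at hk
    exact Nat.Coprime.gcd_mul_left_cancel _ hk
  rw [← h1, kfw_gcd_eq_of_modEq h, h2]

/-! ### The Kloosterman-sum bound for one class, simplified -/

/-- **The `n₂`-sum over one class, bounded by Weil** (the source's (gwp): "`G(…) ≪ M^ε (LN^{1/2} +
(Δ,n₁')𝔭₁/(b𝔭₁²𝔮₂[d,d']))`", here with explicit constants and without the `ε`): let
`S = s₁ s₂`, `s₂ = t₂ n₁` with `(t₂, n₁) = (s₁, s₂) = 1`, `s₁ ∣ q`, `(q, s₂) = 1`, `(ℓ₂, q) = 1`,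
`q ≥ 1`, and suppose `(a, n₁) = (Δ', n₁)` and `(a, t₂) ≤ λ²` (`λ ≥ 1`).  Then for `x₁ ≤ x₂` with
`x₂ - x₁ ≤ R`,
`‖∑_{x₁<x≤x₂, x≡V (q), (x,S)=1, (x,ℓ₂)=1} e(a x̄/S)‖ ≤ 2((R+3)(Δ',n₁)/n₁ + τ(S) √S λ (Δ',n₁)^{1/2} (1 + log S))`.
[cite: BettinChandee2018, §4.1.3 (gwp)] -/
theorem kfw_class_sum_le {S s₁ s₂ t₂ n₁ q ℓ₂ : ℕ} (hS : S = s₁ * s₂) (hs₂ : s₂ = t₂ * n₁)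
    (hs₁ : 0 < s₁) (ht₂ : 0 < t₂) (hn₁ : 0 < n₁) (hcop : s₁.Coprime s₂) (htn : t₂.Coprime n₁)
    (hq : 0 < q) (hqs : q.Coprime s₂) (hdiv : s₁ ∣ q) (hℓ₂ : ℓ₂.Prime) (hℓq : ℓ₂.Coprime q)
    {a Δ : ℤ} (haΔ : Int.gcd a n₁ = Int.gcd Δ n₁) {lam : ℝ} (hlam : 1 ≤ lam)
    (hat : (Int.gcd a t₂ : ℝ) ≤ lam ^ 2) (V x₁ x₂ : ℤ) (hx : x₁ ≤ x₂) {R : ℝ}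
    (hR : ((x₂ - x₁ : ℤ) : ℝ) ≤ R) :
    ‖∑ x ∈ (Finset.Ioc x₁ x₂).filter (fun x : ℤ =>
        x ≡ V [ZMOD q] ∧ (Int.gcd x S = 1 ∧ Int.gcd x ℓ₂ = 1)),
        Complex.exp (2 * Real.pi * Complex.I *
          ((a : ℂ) * ((((x : ZMod S)⁻¹).val : ℕ) : ℂ) / (S : ℂ)))‖ ≤
      2 * ((R + 3) * (Int.gcd Δ n₁ : ℝ) / n₁ +
        (S.divisors.card : ℝ) * Real.sqrt S * lam * Real.sqrt (Int.gcd Δ n₁) *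
          (1 + Real.log S)) := by
  have hs₂0 : 0 < s₂ := by rw [hs₂]; exact Nat.mul_pos ht₂ hn₁
  have hS0 : 0 < S := by rw [hS]; exact Nat.mul_pos hs₁ hs₂0
  have hqm : (q * 1).Coprime s₂ := by rw [mul_one]; exact hqs
  have hdiv' : s₁ ∣ q * 1 := by rw [mul_one]; exact hdiv
  have hδq : ℓ₂.Coprime (q * 1) := by rw [mul_one]; exact hℓq
  have h := KI_sum_interval_progression_le hS hs₁ hs₂0 hcop hq zero_lt_one hqm hdiv' hℓ₂.pos
    hδq a V x₁ x₂ hx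
  refine h.trans ?_
  -- simplify the right-hand side
  rw [Nat.Prime.divisors hℓ₂, Finset.card_pair hℓ₂.one_lt.ne]
  have hn₁r : (0 : ℝ) < n₁ := by exact_mod_cast hn₁
  have ht₂r : (0 : ℝ) < t₂ := by exact_mod_cast ht₂
  have hs₂r : (0 : ℝ) < s₂ := by exact_mod_cast hs₂0
  have hqr : (1 : ℝ) ≤ q := by exact_mod_cast hq
  have hg0 : (0 : ℝ) ≤ Int.gcd Δ n₁ := Nat.cast_nonneg _
  -- the gcd: `(a, s₂) = (a, t₂)(a, n₁) ≤ λ² (Δ', n₁)` and `(a, s₂)/s₂ ≤ (Δ', n₁)/n₁`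
  have hgcd_eq : (Int.gcd a s₂ : ℝ) = (Int.gcd a t₂ : ℝ) * Int.gcd Δ n₁ := by
    rw [← haΔ, hs₂, Int.gcd_eq_natAbs, Int.gcd_eq_natAbs, Int.gcd_eq_natAbs, Int.natAbs_natCast,
      Int.natAbs_natCast, Int.natAbs_natCast, Nat.Coprime.gcd_mul _ htn]
    push_cast; ring
  have hat0 : (1 : ℝ) ≤ Int.gcd a t₂ := by
    exact_mod_cast Nat.gcd_pos_of_pos_right _ ht₂
  have hat_le : (Int.gcd a t₂ : ℝ) ≤ t₂ := by
    exact_mod_cast Nat.le_of_dvd ht₂ (by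
      have := Int.gcd_dvd_right a t₂
      exact_mod_cast this)
  have hmain : (Int.gcd a s₂ : ℝ) / s₂ ≤ (Int.gcd Δ n₁ : ℝ) / n₁ := by
    rw [hgcd_eq, hs₂]; push_cast
    rw [div_le_div_iff₀ (by positivity) hn₁r]
    calc (Int.gcd a t₂ : ℝ) * Int.gcd Δ n₁ * n₁ = Int.gcd a t₂ * (Int.gcd Δ n₁ * n₁) := by ring
      _ ≤ t₂ * (Int.gcd Δ n₁ * n₁) := mul_le_mul_of_nonneg_right hat_le (by positivity)
      _ = Int.gcd Δ n₁ * (t₂ * n₁) := by ring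
  have hsqrt_g : Real.sqrt (Int.gcd a s₂) ≤ lam * Real.sqrt (Int.gcd Δ n₁) := by
    rw [hgcd_eq, Real.sqrt_mul (Nat.cast_nonneg _)]
    refine mul_le_mul_of_nonneg_right ?_ (Real.sqrt_nonneg _)
    calc Real.sqrt (Int.gcd a t₂) ≤ Real.sqrt (lam ^ 2) := Real.sqrt_le_sqrt hat
      _ = lam := Real.sqrt_sq (by linarith)
  -- the other factors
  have hτ : ((Nat.divisors s₂).card : ℝ) ≤ S.divisors.card := by
    exact_mod_cast kfw_card_divisors_le_of_dvd hS0.ne' ⟨s₁, by rw [hS, mul_comm]⟩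
  have hsqrt_s : Real.sqrt s₂ ≤ Real.sqrt S := by
    refine Real.sqrt_le_sqrt ?_
    exact_mod_cast Nat.le_of_dvd hS0 ⟨s₁, by rw [hS, mul_comm]⟩
  have hlog : 1 + Real.log s₂ ≤ 1 + Real.log S := by
    have : (s₂ : ℝ) ≤ S := by exact_mod_cast Nat.le_of_dvd hS0 ⟨s₁, by rw [hS, mul_comm]⟩
    have := Real.log_le_log hs₂r this; linarith
  have hlog0 : 0 ≤ 1 + Real.log s₂ := by
    have := Real.log_nonneg (show (1 : ℝ) ≤ s₂ by exact_mod_cast hs₂0); linarith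
  -- the length factor: `((x₂-x₁)/q + 1)/1 + 2 ≤ R + 3`
  have hlen : (((x₂ - x₁ : ℤ) : ℝ) / q + 1) / (1 : ℕ) + 2 ≤ R + 3 := by
    have h0 : (0 : ℝ) ≤ ((x₂ - x₁ : ℤ) : ℝ) := by exact_mod_cast (sub_nonneg.mpr hx)
    have h1 : ((x₂ - x₁ : ℤ) : ℝ) / q ≤ ((x₂ - x₁ : ℤ) : ℝ) := div_le_self h0 hqr
    have h2 : (((x₂ - x₁ : ℤ) : ℝ) / q + 1) / (1 : ℕ) = ((x₂ - x₁ : ℤ) : ℝ) / q + 1 := by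
      push_cast; ring
    rw [h2]; linarith
  have hlen0 : 0 ≤ (((x₂ - x₁ : ℤ) : ℝ) / q + 1) / (1 : ℕ) + 2 := by
    have h0 : (0 : ℝ) ≤ ((x₂ - x₁ : ℤ) : ℝ) := by exact_mod_cast (sub_nonneg.mpr hx)
    positivity
  have hgs0 : (0 : ℝ) ≤ Int.gcd a s₂ := Nat.cast_nonneg _
  -- assemble
  have hterm1 : ((((x₂ - x₁ : ℤ) : ℝ) / q + 1) / (1 : ℕ) + 2) / s₂ * Int.gcd a s₂ ≤
      (R + 3) * (Int.gcd Δ n₁ : ℝ) / n₁ := by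
    calc ((((x₂ - x₁ : ℤ) : ℝ) / q + 1) / (1 : ℕ) + 2) / s₂ * Int.gcd a s₂
        = ((((x₂ - x₁ : ℤ) : ℝ) / q + 1) / (1 : ℕ) + 2) * ((Int.gcd a s₂ : ℝ) / s₂) := by ring
      _ ≤ (R + 3) * ((Int.gcd Δ n₁ : ℝ) / n₁) :=
          mul_le_mul hlen hmain (by positivity) (by linarith)
      _ = (R + 3) * (Int.gcd Δ n₁ : ℝ) / n₁ := by ring
  have hterm2 : ((Nat.divisors s₂).card : ℝ) * Real.sqrt s₂ * Real.sqrt (Int.gcd a s₂) *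
      (1 + Real.log s₂) ≤
      (S.divisors.card : ℝ) * Real.sqrt S * lam * Real.sqrt (Int.gcd Δ n₁) * (1 + Real.log S) := by
    calc ((Nat.divisors s₂).card : ℝ) * Real.sqrt s₂ * Real.sqrt (Int.gcd a s₂) * (1 + Real.log s₂)
        ≤ (S.divisors.card : ℝ) * Real.sqrt S * (lam * Real.sqrt (Int.gcd Δ n₁)) *
            (1 + Real.log S) := by
          gcongr
      _ = _ := by ring
  calc (1 : ℕ) * ((2 : ℕ) * (((((x₂ - x₁ : ℤ) : ℝ) / q + 1) / (1 : ℕ) + 2) / s₂ * Int.gcd a s₂ +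
          (Nat.divisors s₂).card * Real.sqrt s₂ * Real.sqrt (Int.gcd a s₂) * (1 + Real.log s₂)))
      = 2 * (((((x₂ - x₁ : ℤ) : ℝ) / q + 1) / (1 : ℕ) + 2) / s₂ * Int.gcd a s₂ +
          (Nat.divisors s₂).card * Real.sqrt s₂ * Real.sqrt (Int.gcd a s₂) * (1 + Real.log s₂)) := by
        push_cast; ring
    _ ≤ 2 * ((R + 3) * (Int.gcd Δ n₁ : ℝ) / n₁ +
          (S.divisors.card : ℝ) * Real.sqrt S * lam * Real.sqrt (Int.gcd Δ n₁) *
            (1 + Real.log S)) := by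
        linarith

/-! ### The `n₂`-sum of an off-diagonal pair -/

/-- Reindexing a sum over naturals `N₁ < n ≤ N₂` by integers. [folklore] -/
theorem kfw_sum_Ioc_nat_eq_int (N₁ N₂ : ℕ) (F : ℤ → ℂ) :
    ∑ n ∈ Finset.Ioc N₁ N₂, F (n : ℤ) = ∑ x ∈ Finset.Ioc (N₁ : ℤ) (N₂ : ℤ), F x := by
  refine Finset.sum_nbij' (fun n : ℕ => (n : ℤ)) (fun x : ℤ => x.toNat) ?_ ?_ ?_ ?_ ?_
  · intro n hn
    simp only [Finset.mem_Ioc] at hn ⊢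
    exact ⟨by exact_mod_cast hn.1, by exact_mod_cast hn.2⟩
  · intro x hx
    simp only [Finset.mem_Ioc] at hx ⊢
    constructor <;> omega
  · intro n _; exact Int.toNat_natCast n
  · intro x hx
    simp only [Finset.mem_Ioc] at hx
    exact Int.toNat_of_nonneg (by omega)
  · intro n _; rfl

set_option maxHeartbeats 1000000 in
/-- **Weil's bound for the `n₂`-sum of an off-diagonal pair** (Bettin–Chandee §4.1.3, the terms
`Δ ≠ 0`, case `A = 1`, `𝔭ᵢ = 𝔮ᵢ = 1`, `ℓ₂ = ℓ₂'`, explicit constants).  Fix `k`, `b ≥ 1`, primes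
`ℓ₁, ℓ₁', ℓ₂` coprime to `bk`, `n₁ ≥ 1` coprime to `bk`, `c`, `M₁, M₂`, `N₁ ≤ N₂`, and a pair
`(ℓ₁,d), (ℓ₁',d')` with `d, d' ≠ 0` (the bound is only useful off the diagonal, but holds
unconditionally).  With `S = ℓ₁ℓ₁'n₁`, `Y = dℓ₁' - d'ℓ₁`,
`Δ' = Yℓ₂ - (d-d')ℓ₁ℓ₁'`, `λ = ℓ₁` if `ℓ₁ = ℓ₁'` and `1` otherwise, the sum over
`N₁ < n₂ ≤ N₂`, `(n₂, b) = 1` of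
`[NDC(ℓ₁) ∧ NDC(ℓ₁')] [A(ℓ₁,d) ∧ A(ℓ₁',d')] E(ℓ₁,d) conj E(ℓ₁',d')` (notation of
`KloostermanFractionsOffDiagCS.lean`) has norm at most

  `2 (1 + 2π|k||Y|/(bS(N₁+1))) ((N₂-N₁+3)(Δ',n₁)/n₁ + τ(S) √S λ (Δ',n₁)^{1/2} (1 + log S))`

("We apply Lemma (ks) to the sum over `n₂'`, removing the second summand of (afed) by using
partial summation with the bound `… ≪ |ϑ|AD/(bLN²)` … Thus, Lemma (ks) gives
`G(…) ≪ M^ε (LN^{1/2} + (Δ,n₁')𝔭₁/(b𝔭₁²𝔮₂[d,d'])) (1 + |ϑ|AD/(bLN²))`").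
[cite: BettinChandee2018, §4.1.3 (gwp)–(boudn)] -/
theorem kfw_pair_sum_le (k : ℤ) {b : ℕ} (hb : 0 < b) {ℓ₁ ℓ₁' ℓ₂ : ℕ} (hp₁ : ℓ₁.Prime)
    (hp₁' : ℓ₁'.Prime) (hp₂ : ℓ₂.Prime) (hℓ₁b : ℓ₁.Coprime b) (hℓ₁'b : ℓ₁'.Coprime b)
    (hℓ₂b : ℓ₂.Coprime b) (hℓ₁k : Int.gcd k ℓ₁ = 1) (hℓ₁'k : Int.gcd k ℓ₁' = 1)
    {n₁ : ℕ} (hn₁ : 0 < n₁) (hn₁b : n₁.Coprime b) (hn₁k : Int.gcd k n₁ = 1)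
    {d d' : ℤ} (hd : d ≠ 0) (hd' : d' ≠ 0)
    (c M₁ M₂ N₁ N₂ : ℕ) (hN : N₁ ≤ N₂) :
    ‖∑ n₂ ∈ (Finset.Ioc N₁ N₂).filter (fun n => n.Coprime b),
        (if ((ℓ₁ ≠ ℓ₂ ∧ n₁.Coprime n₂ ∧ (n₁ * n₂).Coprime (ℓ₁ * ℓ₂)) ∧
              (ℓ₁' ≠ ℓ₂ ∧ n₁.Coprime n₂ ∧ (n₁ * n₂).Coprime (ℓ₁' * ℓ₂))) then
          (if ((d ∣ ((ℓ₁ * n₁ : ℤ) - ℓ₂ * n₂) ∧ (M₁ : ℤ) < ((ℓ₁ * n₁ : ℤ) - ℓ₂ * n₂) / d ∧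
                  ((ℓ₁ * n₁ : ℤ) - ℓ₂ * n₂) / d ≤ M₂ ∧
                  ((ℓ₁ * n₁ : ℤ) - ℓ₂ * n₂) / d ≡ (c : ℤ) [ZMOD b]) ∧
               (d' ∣ ((ℓ₁' * n₁ : ℤ) - ℓ₂ * n₂) ∧ (M₁ : ℤ) < ((ℓ₁' * n₁ : ℤ) - ℓ₂ * n₂) / d' ∧
                  ((ℓ₁' * n₁ : ℤ) - ℓ₂ * n₂) / d' ≤ M₂ ∧
                  ((ℓ₁' * n₁ : ℤ) - ℓ₂ * n₂) / d' ≡ (c : ℤ) [ZMOD b])) then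
            (Complex.exp (2 * Real.pi * Complex.I *
                (((-(k * d) : ℤ) : ℂ) * (((((b * (ℓ₂ * n₂ : ℤ) : ℤ) : ZMod n₁)⁻¹).val : ℕ) : ℂ) /
                  (n₁ : ℂ))) *
              (starRingEnd ℂ) (Complex.exp (2 * Real.pi * Complex.I *
                (((-(k * d) : ℤ) : ℂ) *
                  (((((b * (-(ℓ₁ * n₁ : ℤ)) : ℤ) : ZMod n₂)⁻¹).val : ℕ) : ℂ) / (n₂ : ℂ))))) *
            (starRingEnd ℂ) (Complex.exp (2 * Real.pi * Complex.I *
                (((-(k * d') : ℤ) : ℂ) * (((((b * (ℓ₂ * n₂ : ℤ) : ℤ) : ZMod n₁)⁻¹).val : ℕ) : ℂ) /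
                  (n₁ : ℂ))) *
              (starRingEnd ℂ) (Complex.exp (2 * Real.pi * Complex.I *
                (((-(k * d') : ℤ) : ℂ) *
                  (((((b * (-(ℓ₁' * n₁ : ℤ)) : ℤ) : ZMod n₂)⁻¹).val : ℕ) : ℂ) / (n₂ : ℂ)))))
          else 0)
        else 0)‖ ≤
      2 * (1 + 2 * Real.pi * |(k : ℝ)| * |((d * ℓ₁' - d' * ℓ₁ : ℤ) : ℝ)| /
          ((b : ℝ) * (ℓ₁ * ℓ₁' * n₁ : ℕ) * ((N₁ : ℝ) + 1))) *
        (((N₂ : ℝ) - N₁ + 3) *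
            (Int.gcd ((d * ℓ₁' - d' * ℓ₁) * ℓ₂ - (d - d') * (ℓ₁ * ℓ₁' : ℕ)) n₁ : ℝ) / n₁ +
          ((ℓ₁ * ℓ₁' * n₁ : ℕ).divisors.card : ℝ) * Real.sqrt ((ℓ₁ * ℓ₁' * n₁ : ℕ) : ℝ) *
            (if ℓ₁ = ℓ₁' then (ℓ₁ : ℝ) else 1) *
            Real.sqrt (Int.gcd ((d * ℓ₁' - d' * ℓ₁) * ℓ₂ - (d - d') * (ℓ₁ * ℓ₁' : ℕ)) n₁ : ℝ) *
            (1 + Real.log ((ℓ₁ * ℓ₁' * n₁ : ℕ) : ℝ))) := by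
  classical
  -- notation
  set S : ℕ := ℓ₁ * ℓ₁' * n₁ with hSdef
  set Y : ℤ := d * ℓ₁' - d' * ℓ₁ with hY
  set Δ : ℤ := Y * ℓ₂ - (d - d') * (ℓ₁ * ℓ₁' : ℕ) with hΔ
  set lam : ℝ := (if ℓ₁ = ℓ₁' then (ℓ₁ : ℝ) else 1) with hlam
  set RHS : ℝ := 2 * (1 + 2 * Real.pi * |(k : ℝ)| * |(Y : ℝ)| / ((b : ℝ) * S * ((N₁ : ℝ) + 1))) *
    (((N₂ : ℝ) - N₁ + 3) * (Int.gcd Δ n₁ : ℝ) / n₁ +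
      (S.divisors.card : ℝ) * Real.sqrt (S : ℝ) * lam * Real.sqrt (Int.gcd Δ n₁ : ℝ) *
        (1 + Real.log (S : ℝ))) with hRHS
  have hS0 : 0 < S := Nat.mul_pos (Nat.mul_pos hp₁.pos hp₁'.pos) hn₁
  have hS1 : 1 < S := by
    calc 1 < 2 * 2 * 1 := by norm_num
      _ ≤ ℓ₁ * ℓ₁' * n₁ := Nat.mul_le_mul (Nat.mul_le_mul hp₁.two_le hp₁'.two_le) hn₁
  have hlam1 : 1 ≤ lam := by
    rw [hlam]; split_ifs
    · exact_mod_cast hp₁.one_lt.le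
    · exact le_rfl
  have hRHS0 : 0 ≤ RHS := by
    have h1 : 0 ≤ (N₂ : ℝ) - N₁ + 3 := by
      have : (N₁ : ℝ) ≤ N₂ := by exact_mod_cast hN
      linarith
    have h2 : 0 ≤ 1 + Real.log (S : ℝ) := by
      have := Real.log_nonneg (show (1 : ℝ) ≤ S by exact_mod_cast hS0); linarith
    have h3 : 0 ≤ lam := le_trans zero_le_one hlam1
    rw [hRHS]; positivity
  show _ ≤ RHS
  set T₂ := (Finset.Ioc N₁ N₂).filter (fun n => n.Coprime b) with hT₂
  -- the predicates
  set NDC : ℕ → ℕ → Prop := fun l n₂ => l ≠ ℓ₂ ∧ n₁.Coprime n₂ ∧ (n₁ * n₂).Coprime (l * ℓ₂)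
    with hNDC
  set Acond : ℕ → ℤ → ℕ → Prop := fun l dd n₂ =>
    dd ∣ ((l * n₁ : ℤ) - ℓ₂ * n₂) ∧ (M₁ : ℤ) < ((l * n₁ : ℤ) - ℓ₂ * n₂) / dd ∧
      ((l * n₁ : ℤ) - ℓ₂ * n₂) / dd ≤ M₂ ∧ ((l * n₁ : ℤ) - ℓ₂ * n₂) / dd ≡ (c : ℤ) [ZMOD b]
    with hAcond
  -- Step 1: if no `n₂` satisfies all conditions, the sum vanishes
  by_cases hex : ∃ n₂ ∈ T₂, (NDC ℓ₁ n₂ ∧ NDC ℓ₁' n₂) ∧ (Acond ℓ₁ d n₂ ∧ Acond ℓ₁' d' n₂)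
  swap
  · rw [Finset.sum_eq_zero, norm_zero]
    · exact hRHS0
    intro n₂ hn₂
    push Not at hex
    by_cases h1 : NDC ℓ₁ n₂ ∧ NDC ℓ₁' n₂
    · have h2 := hex n₂ hn₂ h1
      simp only [hNDC] at h1
      simp only [hAcond] at h2
      rw [if_pos h1, if_neg (fun h => h2 h.1 h.2)]
    · simp only [hNDC] at h1
      rw [if_neg h1]
  obtain ⟨n₀, hn₀T, ⟨hNDC₀, hNDC₀'⟩, ⟨hA₀, hA₀'⟩⟩ := hex
  simp only [hNDC] at hNDC₀ hNDC₀'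
  simp only [hAcond] at hA₀ hA₀'
  obtain ⟨hne₁, hn₁n₀, hcop₀⟩ := hNDC₀
  obtain ⟨hne₁', -, hcop₀'⟩ := hNDC₀'
  -- the good facts, from the witness `n₀`
  have hκ₁ : n₁.Coprime (ℓ₁ * ℓ₂) := Nat.Coprime.coprime_mul_right hcop₀
  have hκ₁' : n₁.Coprime (ℓ₁' * ℓ₂) := Nat.Coprime.coprime_mul_right hcop₀'
  have hn₀ℓ : n₀.Coprime (ℓ₁ * ℓ₂) := Nat.Coprime.coprime_mul_left hcop₀
  have hn₀ℓ' : n₀.Coprime (ℓ₁' * ℓ₂) := Nat.Coprime.coprime_mul_left hcop₀'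
  have hn₁ℓ₂ : n₁.Coprime ℓ₂ := Nat.Coprime.coprime_mul_left_right hκ₁
  have hn₁ℓ₁ : n₁.Coprime ℓ₁ := Nat.Coprime.coprime_mul_right_right hκ₁
  have hn₁ℓ₁' : n₁.Coprime ℓ₁' := Nat.Coprime.coprime_mul_right_right hκ₁'
  have h12 : ℓ₁ ≠ ℓ₂ := hne₁
  have h12' : ℓ₁' ≠ ℓ₂ := hne₁'
  have hgood : ∀ (l : ℕ) (dd : ℤ), l.Prime → l ≠ ℓ₂ → n₀.Coprime (l * ℓ₂) →
      n₁.Coprime (l * ℓ₂) → dd ∣ ((l * n₁ : ℤ) - ℓ₂ * n₀) →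
      Int.gcd dd n₁ = 1 ∧ ¬ ((l : ℤ) ∣ dd) ∧ Int.gcd dd ℓ₂ = 1 := by
    intro l dd hl hlne hn₀l hn₁l hdd
    have hn₀l' : n₀.Coprime l := Nat.Coprime.coprime_mul_right_right hn₀l
    have hn₁ℓ₂' : n₁.Coprime ℓ₂ := Nat.Coprime.coprime_mul_left_right hn₁l
    have hlℓ₂ : l.Coprime ℓ₂ := (Nat.coprime_primes hl hp₂).mpr hlne
    refine ⟨?_, ?_, ?_⟩
    · set g := Int.gcd dd n₁ with hg
      have hg1 : (g : ℤ) ∣ (ℓ₂ * n₀ : ℤ) := by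
        have h1 : (g : ℤ) ∣ (l * n₁ : ℤ) - ℓ₂ * n₀ := (Int.gcd_dvd_left _ _).trans hdd
        have h2 : (g : ℤ) ∣ (l * n₁ : ℤ) := (Int.gcd_dvd_right _ _).mul_left _
        have : (ℓ₂ * n₀ : ℤ) = l * n₁ - ((l * n₁ : ℤ) - ℓ₂ * n₀) := by ring
        rw [this]; exact dvd_sub h2 h1
      have hg1' : g ∣ ℓ₂ * n₀ := by exact_mod_cast hg1
      have hg2 : g ∣ n₁ := by have := Int.gcd_dvd_right dd n₁; exact_mod_cast this
      have hc : (ℓ₂ * n₀).Coprime n₁ := Nat.Coprime.mul_left hn₁ℓ₂'.symm hn₁n₀.symm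
      have := Nat.dvd_gcd hg1' hg2
      rwa [Nat.Coprime.gcd_eq_one hc, Nat.dvd_one] at this
    · intro hl1
      have h1 : (l : ℤ) ∣ (l * n₁ : ℤ) - ℓ₂ * n₀ := hl1.trans hdd
      have h2 : (l : ℤ) ∣ (ℓ₂ * n₀ : ℤ) := by
        have : (ℓ₂ * n₀ : ℤ) = l * n₁ - ((l * n₁ : ℤ) - ℓ₂ * n₀) := by ring
        rw [this]; exact dvd_sub (dvd_mul_right _ _) h1
      have h3 : l ∣ ℓ₂ * n₀ := by exact_mod_cast h2
      rcases (Nat.Prime.dvd_mul hl).mp h3 with h4 | h4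
      · exact hlne ((Nat.prime_dvd_prime_iff_eq hl hp₂).mp h4)
      · exact (Nat.Prime.coprime_iff_not_dvd hl).mp hn₀l'.symm h4
    · set g := Int.gcd dd ℓ₂ with hg
      have hg1 : (g : ℤ) ∣ (l * n₁ : ℤ) := by
        have h1 : (g : ℤ) ∣ (l * n₁ : ℤ) - ℓ₂ * n₀ := (Int.gcd_dvd_left _ _).trans hdd
        have h2 : (g : ℤ) ∣ (ℓ₂ * n₀ : ℤ) := (Int.gcd_dvd_right _ _).mul_right _
        have : (l * n₁ : ℤ) = ((l * n₁ : ℤ) - ℓ₂ * n₀) + ℓ₂ * n₀ := by ring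
        rw [this]; exact dvd_add h1 h2
      have hg1' : g ∣ l * n₁ := by exact_mod_cast hg1
      have hg2 : g ∣ ℓ₂ := by have := Int.gcd_dvd_right dd ℓ₂; exact_mod_cast this
      have hc : (l * n₁).Coprime ℓ₂ := Nat.Coprime.mul_left hlℓ₂ hn₁ℓ₂'
      have := Nat.dvd_gcd hg1' hg2
      rwa [Nat.Coprime.gcd_eq_one hc, Nat.dvd_one] at this
  obtain ⟨hdn₁, hℓ₁d, hdℓ₂⟩ := hgood ℓ₁ d hp₁ h12 hn₀ℓ hκ₁ hA₀.1
  obtain ⟨hd'n₁, hℓ₁'d', hd'ℓ₂⟩ := hgood ℓ₁' d' hp₁' h12' hn₀ℓ' hκ₁' hA₀'.1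
  -- more coprimality
  have hc₁ : (b * ℓ₂).Coprime n₁ := Nat.Coprime.mul_left hn₁b.symm hn₁ℓ₂.symm
  have hbS : b.Coprime S := by
    rw [hSdef]
    exact Nat.Coprime.mul_right (Nat.Coprime.mul_right hℓ₁b.symm hℓ₁'b.symm) hn₁b.symm
  have ht : 0 < ℓ₁ * ℓ₁' := Nat.mul_pos hp₁.pos hp₁'.pos
  have htn₁ : (ℓ₁ * ℓ₁').Coprime n₁ := Nat.Coprime.mul_left hn₁ℓ₁.symm hn₁ℓ₁'.symm
  -- Step 2: the phases (`kfw_pair_final`)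
  set σ₁ : ℕ := (((b * ℓ₂ : ℕ) : ZMod n₁)⁻¹).val with hσ₁
  set σ : ℕ := ((b : ZMod S)⁻¹).val with hσ
  set a : ℤ := (-(k * (d - d'))) * σ₁ * (ℓ₁ * ℓ₁' : ℕ) + (k * Y) * σ with ha
  set θ : ℝ := (-(k * Y) : ℝ) / ((b : ℝ) * S) with hθ
  set Cb : ℤ → ℂ := fun x => Complex.exp (2 * Real.pi * Complex.I *
    (((k * Y : ℤ) : ℂ) * ((((((x * (S : ℕ) : ℤ)) : ZMod b)⁻¹).val : ℕ) : ℂ) / (b : ℂ))) with hCb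
  set g : ℤ → ℂ := fun x => Complex.exp (2 * Real.pi * Complex.I *
    ((a : ℂ) * ((((x : ZMod S)⁻¹).val : ℕ) : ℂ) / (S : ℂ))) with hg
  set f : ℤ → ℂ := fun x => Complex.exp (2 * Real.pi * Complex.I * ((θ : ℂ) / (x : ℂ))) with hf
  set P : ℕ → ℂ := fun n₂ =>
    (Complex.exp (2 * Real.pi * Complex.I *
        (((-(k * d) : ℤ) : ℂ) * (((((b * (ℓ₂ * n₂ : ℤ) : ℤ) : ZMod n₁)⁻¹).val : ℕ) : ℂ) /
          (n₁ : ℂ))) *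
      (starRingEnd ℂ) (Complex.exp (2 * Real.pi * Complex.I *
        (((-(k * d) : ℤ) : ℂ) * (((((b * (-(ℓ₁ * n₁ : ℤ)) : ℤ) : ZMod n₂)⁻¹).val : ℕ) : ℂ) /
          (n₂ : ℂ))))) *
    (starRingEnd ℂ) (Complex.exp (2 * Real.pi * Complex.I *
        (((-(k * d') : ℤ) : ℂ) * (((((b * (ℓ₂ * n₂ : ℤ) : ℤ) : ZMod n₁)⁻¹).val : ℕ) : ℂ) /
          (n₁ : ℂ))) *
      (starRingEnd ℂ) (Complex.exp (2 * Real.pi * Complex.I *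
        (((-(k * d') : ℤ) : ℂ) *
          (((((b * (-(ℓ₁' * n₁ : ℤ)) : ℤ) : ZMod n₂)⁻¹).val : ℕ) : ℂ) / (n₂ : ℂ))))) with hP
  show ‖∑ n₂ ∈ T₂, (if (NDC ℓ₁ n₂ ∧ NDC ℓ₁' n₂) then
      (if (Acond ℓ₁ d n₂ ∧ Acond ℓ₁' d' n₂) then P n₂ else 0) else 0)‖ ≤ RHS
  have htw : ∀ n₂ : ℕ, 0 < n₂ →
      Complex.exp (2 * Real.pi * Complex.I *
        (((-(k * (d * ℓ₁' - d' * ℓ₁)) : ℤ) : ℂ) / ((b * (ℓ₁ * ℓ₁' * n₁) * n₂ : ℕ) : ℂ))) =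
      f (n₂ : ℤ) := by
    intro n₂ hn₂
    simp only [hf, hθ, hY, hSdef]
    congr 1
    have hb0 : (b : ℂ) ≠ 0 := by exact_mod_cast hb.ne'
    have hS0' : ((ℓ₁ * ℓ₁' * n₁ : ℕ) : ℂ) ≠ 0 := by exact_mod_cast hS0.ne'
    have hn0 : (n₂ : ℂ) ≠ 0 := by exact_mod_cast hn₂.ne'
    push_cast
    field_simp
  have hpt : ∀ n₂ ∈ T₂, (if (NDC ℓ₁ n₂ ∧ NDC ℓ₁' n₂) then
      (if (Acond ℓ₁ d n₂ ∧ Acond ℓ₁' d' n₂) then P n₂ else 0) else 0) =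
      (if ((NDC ℓ₁ n₂ ∧ NDC ℓ₁' n₂) ∧ (Acond ℓ₁ d n₂ ∧ Acond ℓ₁' d' n₂)) then
        Cb (n₂ : ℤ) * (g (n₂ : ℤ) * f (n₂ : ℤ)) else 0) := by
    intro n₂ hn₂
    have hn₂' := Finset.mem_filter.mp hn₂
    have hn₂pos : 0 < n₂ := lt_of_le_of_lt (Nat.zero_le _) (Finset.mem_Ioc.mp hn₂'.1).1
    by_cases hR : (NDC ℓ₁ n₂ ∧ NDC ℓ₁' n₂) ∧ (Acond ℓ₁ d n₂ ∧ Acond ℓ₁' d' n₂)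
    · rw [if_pos hR.1, if_pos hR.2, if_pos hR]
      obtain ⟨⟨⟨-, hnn, hnl⟩, ⟨-, -, hnl'⟩⟩, -⟩ := hR
      have hn₂ℓ₁ : n₂.Coprime ℓ₁ :=
        Nat.Coprime.coprime_mul_right_right (Nat.Coprime.coprime_mul_left hnl)
      have hn₂ℓ₁' : n₂.Coprime ℓ₁' :=
        Nat.Coprime.coprime_mul_right_right (Nat.Coprime.coprime_mul_left hnl')
      have hBn : (b * (ℓ₁ * ℓ₁' * n₁)).Coprime n₂ := by
        refine Nat.Coprime.mul_left hn₂'.2.symm ?_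
        exact Nat.Coprime.mul_left (Nat.Coprime.mul_left hn₂ℓ₁.symm hn₂ℓ₁'.symm) hnn
      simp only [hP]
      rw [kfw_pair_final k d d' hb hp₁.pos hp₁'.pos hn₁ hn₂pos hS1 hc₁ hbS hBn, htw n₂ hn₂pos]
      simp only [hCb, hg, ha, hY, hσ₁, hσ, hSdef]
      ring
    · rw [if_neg hR]
      by_cases h1 : NDC ℓ₁ n₂ ∧ NDC ℓ₁' n₂
      · rw [if_pos h1, if_neg (fun h2 => hR ⟨h1, h2⟩)]
      · rw [if_neg h1]
  rw [Finset.sum_congr rfl hpt]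
  -- Step 3: the conditions as a predicate on integers
  set RealJ : ℕ → ℤ → ℤ → Prop := fun l dd x =>
    (M₁ : ℝ) < (((l * n₁ : ℤ) - ℓ₂ * x : ℤ) : ℝ) / (dd : ℝ) ∧
      (((l * n₁ : ℤ) - ℓ₂ * x : ℤ) : ℝ) / (dd : ℝ) ≤ (M₂ : ℝ) with hRealJ
  set CongD : ℕ → ℤ → ℤ → Prop := fun l dd x =>
    ((b * dd.natAbs : ℕ) : ℤ) ∣ ((l * n₁ : ℤ) - c * dd) - ℓ₂ * x with hCongD
  set Q₂ : ℤ → Prop := fun x => Int.gcd x b = 1 ∧ (Int.gcd x S = 1 ∧ Int.gcd x ℓ₂ = 1) ∧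
    (CongD ℓ₁ d x ∧ CongD ℓ₁' d' x) with hQ₂
  set Q : ℤ → Prop := fun x => (RealJ ℓ₁ d x ∧ RealJ ℓ₁' d' x) ∧ Q₂ x with hQ
  have hAiff : ∀ (l : ℕ) (dd : ℤ), dd ≠ 0 → ∀ n₂ : ℕ,
      Acond l dd n₂ ↔ RealJ l dd n₂ ∧ CongD l dd n₂ := by
    intro l dd hdd n₂
    simp only [hAcond, hRealJ, hCongD]
    rw [kfw_dcond_iff hdd b]
    have e1 : ((b * dd.natAbs : ℕ) : ℤ) = (b : ℤ) * |dd| := by push_cast; rfl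
    have e2 : (l * n₁ : ℤ) - c * dd - ℓ₂ * n₂ = ((l * n₁ : ℤ) - ℓ₂ * n₂) - c * dd := by ring
    rw [e1, e2]
    simp only [Int.cast_natCast]
  have hNiff : ∀ n₂ : ℕ, (NDC ℓ₁ n₂ ∧ NDC ℓ₁' n₂) ↔ (n₂.Coprime S ∧ n₂.Coprime ℓ₂) := by
    intro n₂
    simp only [hNDC]
    constructor
    · rintro ⟨⟨-, hnn, hnl⟩, ⟨-, -, hnl'⟩⟩
      have h1 : n₂.Coprime (ℓ₁ * ℓ₂) := Nat.Coprime.coprime_mul_left hnl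
      have h2 : n₂.Coprime (ℓ₁' * ℓ₂) := Nat.Coprime.coprime_mul_left hnl'
      refine ⟨?_, Nat.Coprime.coprime_mul_left_right h1⟩
      rw [hSdef]
      exact Nat.Coprime.mul_right (Nat.Coprime.mul_right
        (Nat.Coprime.coprime_mul_right_right h1) (Nat.Coprime.coprime_mul_right_right h2))
        hnn.symm
    · rintro ⟨hS', hℓ₂'⟩
      rw [hSdef] at hS'
      have h1 : n₂.Coprime ℓ₁ := Nat.Coprime.coprime_mul_right_right
        (Nat.Coprime.coprime_mul_right_right hS' : n₂.Coprime (ℓ₁ * ℓ₁'))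
      have h2 : n₂.Coprime ℓ₁' := Nat.Coprime.coprime_mul_left_right
        (Nat.Coprime.coprime_mul_right_right hS' : n₂.Coprime (ℓ₁ * ℓ₁'))
      have h3 : n₂.Coprime n₁ := Nat.Coprime.coprime_mul_left_right hS'
      exact ⟨⟨h12, h3.symm, Nat.Coprime.mul_left hκ₁ (Nat.Coprime.mul_right h1 hℓ₂')⟩,
        ⟨h12', h3.symm, Nat.Coprime.mul_left hκ₁' (Nat.Coprime.mul_right h2 hℓ₂')⟩⟩
  have hRQ : ∀ n₂ : ℕ, (n₂.Coprime b ∧ ((NDC ℓ₁ n₂ ∧ NDC ℓ₁' n₂) ∧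
      (Acond ℓ₁ d n₂ ∧ Acond ℓ₁' d' n₂))) ↔ Q (n₂ : ℤ) := by
    intro n₂
    rw [hNiff, hAiff ℓ₁ d hd, hAiff ℓ₁' d' hd']
    simp only [hQ, hQ₂, Nat.Coprime, ← Int.gcd_natCast_natCast]
    tauto
  have hsumZ : ∑ n₂ ∈ T₂, (if ((NDC ℓ₁ n₂ ∧ NDC ℓ₁' n₂) ∧ (Acond ℓ₁ d n₂ ∧ Acond ℓ₁' d' n₂))
      then Cb (n₂ : ℤ) * (g (n₂ : ℤ) * f (n₂ : ℤ)) else 0) =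
      ∑ x ∈ (Finset.Ioc (N₁ : ℤ) (N₂ : ℤ)).filter Q, Cb x * (g x * f x) := by
    rw [hT₂, Finset.sum_filter, Finset.sum_filter]
    rw [← kfw_sum_Ioc_nat_eq_int N₁ N₂ (fun x => if Q x then Cb x * (g x * f x) else 0)]
    refine Finset.sum_congr rfl fun n₂ _ => ?_
    by_cases h1 : n₂.Coprime b
    · by_cases h2 : (NDC ℓ₁ n₂ ∧ NDC ℓ₁' n₂) ∧ (Acond ℓ₁ d n₂ ∧ Acond ℓ₁' d' n₂)
      · rw [if_pos h1, if_pos h2, if_pos ((hRQ n₂).mp ⟨h1, h2⟩)]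
      · rw [if_pos h1, if_neg h2, if_neg (fun h => h2 ((hRQ n₂).mpr h).2)]
    · rw [if_neg h1, if_neg (fun h => h1 ((hRQ n₂).mpr h).1)]
  rw [hsumZ]
  -- Step 4: the real conditions cut out an interval
  have hconv : ∀ a' b' c' : ℤ, a' ≤ b' → b' ≤ c' →
      (RealJ ℓ₁ d a' ∧ RealJ ℓ₁' d' a') → (RealJ ℓ₁ d c' ∧ RealJ ℓ₁' d' c') →
      (RealJ ℓ₁ d b' ∧ RealJ ℓ₁' d' b') := by
    intro a' b' c' hab hbc ha hc
    simp only [hRealJ] at ha hc ⊢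
    push_cast at ha hc ⊢
    have hdr : (d : ℝ) ≠ 0 := by exact_mod_cast hd
    have hdr' : (d' : ℝ) ≠ 0 := by exact_mod_cast hd'
    exact ⟨kfw_affine_convex _ _ _ _ _ hdr a' b' c' hab hbc ha.1 hc.1,
      kfw_affine_convex _ _ _ _ _ hdr' a' b' c' hab hbc ha.2 hc.2⟩
  obtain ⟨x₁, x₂, hx₁, hx₁₂, hx₂, hIoc⟩ := kfw_convex_filter_eq_Ioc
    (show (N₁ : ℤ) ≤ N₂ by exact_mod_cast hN) (fun x => RealJ ℓ₁ d x ∧ RealJ ℓ₁' d' x) hconv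
  have hfilt : (Finset.Ioc (N₁ : ℤ) (N₂ : ℤ)).filter Q = (Finset.Ioc x₁ x₂).filter Q₂ := by
    rw [← hIoc, Finset.filter_filter]
  rw [hfilt]
  -- Step 5: the witness `(n₀ : ℤ) = n₀` and the single congruence
  have hQn₀ : Q (n₀ : ℤ) := (hRQ n₀).mp ⟨(Finset.mem_filter.mp hn₀T).2,
    ⟨⟨⟨hne₁, hn₁n₀, hcop₀⟩, by simp only [hNDC]; exact ⟨hne₁', hn₁n₀, hcop₀'⟩⟩, ⟨hA₀, hA₀'⟩⟩⟩
  have hn₀mem : (n₀ : ℤ) ∈ (Finset.Ioc x₁ x₂).filter Q₂ := by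
    rw [← hfilt, Finset.mem_filter]
    refine ⟨?_, hQn₀⟩
    have := (Finset.mem_filter.mp hn₀T).1
    rw [Finset.mem_Ioc] at this ⊢
    exact ⟨by exact_mod_cast this.1, by exact_mod_cast this.2⟩
  have hQ₂n₀ : Q₂ (n₀ : ℤ) := (Finset.mem_filter.mp hn₀mem).2
  -- the two congruences
  have hq₁ : 0 < b * d.natAbs := Nat.mul_pos hb (Int.natAbs_pos.mpr hd)
  have hq₂ : 0 < b * d'.natAbs := Nat.mul_pos hb (Int.natAbs_pos.mpr hd')
  have hℓq₁ : ℓ₂.Coprime (b * d.natAbs) := by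
    refine Nat.Coprime.mul_right hℓ₂b ?_
    have h1 : Nat.gcd d.natAbs ℓ₂ = 1 := by
      rw [Int.gcd_eq_natAbs, Int.natAbs_natCast] at hdℓ₂; exact hdℓ₂
    exact Nat.Coprime.symm h1
  have hℓq₂ : ℓ₂.Coprime (b * d'.natAbs) := by
    refine Nat.Coprime.mul_right hℓ₂b ?_
    have h1 : Nat.gcd d'.natAbs ℓ₂ = 1 := by
      rw [Int.gcd_eq_natAbs, Int.natAbs_natCast] at hd'ℓ₂; exact hd'ℓ₂
    exact Nat.Coprime.symm h1
  have hCD₁ := fun x => kfw_lin_cong_iff hq₁ hℓq₁ ((ℓ₁ * n₁ : ℤ) - c * d) x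
  have hCD₂ := fun x => kfw_lin_cong_iff hq₂ hℓq₂ ((ℓ₁' * n₁ : ℤ) - c * d') x
  have hn₀₁ := (hCD₁ (n₀ : ℤ)).mp hQ₂n₀.2.2.1
  have hn₀₂ := (hCD₂ (n₀ : ℤ)).mp hQ₂n₀.2.2.2
  set q : ℕ := Nat.lcm (b * d.natAbs) (b * d'.natAbs) with hqdef
  have hq : 0 < q := Nat.lcm_pos hq₁ hq₂
  have htwo : ∀ x : ℤ, (CongD ℓ₁ d x ∧ CongD ℓ₁' d' x) ↔ x ≡ (n₀ : ℤ) [ZMOD q] := by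
    intro x
    simp only [hCongD]
    rw [hCD₁ x, hCD₂ x]
    exact kfw_two_cong_iff hn₀₁ hn₀₂ x
  have hbq : (b : ℤ) ∣ (q : ℤ) :=
    Int.natCast_dvd_natCast.mpr ((Dvd.intro _ rfl).trans (Nat.dvd_lcm_left _ _))
  have hgcdb : ∀ x : ℤ, x ≡ (n₀ : ℤ) [ZMOD q] → Int.gcd x b = 1 := by
    intro x hx
    rw [kfw_gcd_eq_of_modEq (Int.ModEq.of_dvd hbq hx)]
    exact hQ₂n₀.1
  have hfilt2 : (Finset.Ioc x₁ x₂).filter Q₂ = (Finset.Ioc x₁ x₂).filter (fun x : ℤ =>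
      x ≡ (n₀ : ℤ) [ZMOD q] ∧ (Int.gcd x S = 1 ∧ Int.gcd x ℓ₂ = 1)) := by
    refine Finset.filter_congr fun x _ => ?_
    simp only [hQ₂]
    constructor
    · rintro ⟨_, h2, h3⟩; exact ⟨(htwo x).mp h3, h2⟩
    · rintro ⟨h1, h2⟩; exact ⟨hgcdb x h1, h2, (htwo x).mpr h1⟩
  rw [hfilt2]
  -- Step 6: the factor `Cb` is constant on the class
  have hCbconst : ∀ x ∈ (Finset.Ioc x₁ x₂).filter (fun x : ℤ =>
      x ≡ (n₀ : ℤ) [ZMOD q] ∧ (Int.gcd x S = 1 ∧ Int.gcd x ℓ₂ = 1)),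
      Cb x * (g x * f x) = Cb (n₀ : ℤ) * (g x * f x) := by
    intro x hx
    have h := (Finset.mem_filter.mp hx).2.1
    simp only [hCb]
    rw [kfs_phase_mod_b (k * Y) b S (Int.ModEq.of_dvd hbq h)]
  rw [Finset.sum_congr rfl hCbconst, ← Finset.mul_sum, norm_mul]
  have hCbn : ‖Cb (n₀ : ℤ)‖ = 1 := by
    simp only [hCb]
    have h : 2 * (Real.pi : ℂ) * Complex.I *
        (((k * Y : ℤ) : ℂ) * (((((((n₀ : ℤ) * (S : ℕ) : ℤ)) : ZMod b)⁻¹).val : ℕ) : ℂ) / (b : ℂ)) =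
        (((2 * Real.pi * (((k * Y : ℤ) : ℝ) * (((((((n₀ : ℤ) * (S : ℕ) : ℤ)) : ZMod b)⁻¹).val : ℕ) : ℝ)
          / (b : ℝ)) : ℝ)) : ℂ) * Complex.I := by
      push_cast; ring
    rw [h, Complex.norm_exp_ofReal_mul_I]
  rw [hCbn, one_mul]
  -- Step 7a: the arithmetic of the frequency `a`
  have hfreq := kfw_freq_congr k d d' hSdef hn₁ ht hc₁ hbS Y
  have hfreqS : a * ((b * ℓ₂ : ℕ) : ℤ) ≡ k * Δ [ZMOD S] := by
    rw [← ZMod.intCast_eq_intCast_iff]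
    simp only [ha, hΔ, hσ₁, hσ]
    push_cast at hfreq ⊢
    exact hfreq
  have hn₁S : (n₁ : ℤ) ∣ (S : ℤ) := Int.natCast_dvd_natCast.mpr ⟨ℓ₁ * ℓ₁', by rw [hSdef]; ring⟩
  have haΔ : Int.gcd a n₁ = Int.gcd Δ n₁ := by
    refine kfw_gcd_freq_eq (Int.ModEq.of_dvd hn₁S hfreqS) ?_ hn₁k
    rw [Int.gcd_natCast_natCast]; exact hc₁
  -- primes as integers
  have hprime_dvd : ∀ (p : ℕ), p.Prime → ∀ (u v : ℤ), Int.gcd u p = 1 → (p : ℤ) ∣ u * v →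
      (p : ℤ) ∣ v := by
    intro p hp u v hu huv
    have hcop : IsCoprime (p : ℤ) u := by
      rw [Int.isCoprime_iff_gcd_eq_one, Int.gcd_comm]; exact hu
    exact hcop.dvd_of_dvd_mul_left huv
  have hgcd_prime : ∀ (p p' : ℕ), p.Prime → p'.Prime → p ≠ p' → Int.gcd (p' : ℤ) p = 1 := by
    intro p p' hp hp' hne
    rw [Int.gcd_natCast_natCast]
    exact (Nat.coprime_primes hp' hp).mpr (Ne.symm hne)
  -- `(a, t₂) ≤ λ²` for `t₂ ∣ ℓ₁ℓ₁'`
  have hat' : ∀ t₂ : ℕ, t₂ ∣ ℓ₁ * ℓ₁' → 0 < t₂ → (Int.gcd a t₂ : ℝ) ≤ lam ^ 2 := by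
    intro t₂ ht₂ ht₂0
    by_cases hℓeq : ℓ₁ = ℓ₁'
    · have hl : lam = ℓ₁ := by rw [hlam, if_pos hℓeq]
      rw [hl]
      have h1 : Int.gcd a t₂ ≤ t₂ := Nat.le_of_dvd ht₂0 (by
        have := Int.gcd_dvd_right a t₂; exact_mod_cast this)
      have h2 : t₂ ≤ ℓ₁ * ℓ₁' := Nat.le_of_dvd ht ht₂
      calc (Int.gcd a t₂ : ℝ) ≤ t₂ := by exact_mod_cast h1
        _ ≤ ((ℓ₁ * ℓ₁' : ℕ) : ℝ) := by exact_mod_cast h2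
        _ = (ℓ₁ : ℝ) ^ 2 := by rw [← hℓeq]; push_cast; ring
    · have hl : lam = 1 := by rw [hlam, if_neg hℓeq]
      rw [hl, one_pow]
      -- `ℓ₁ ∤ a` and `ℓ₁' ∤ a`
      have hΔdvd : ∀ (p : ℕ), p.Prime → (p ∣ ℓ₁ * ℓ₁') → Int.gcd k p = 1 → (p : ℤ) ∣ a →
          (p : ℤ) ∣ Δ := by
        intro p hp hpS hkp hpa
        have hpS' : (p : ℤ) ∣ (S : ℤ) :=
          Int.natCast_dvd_natCast.mpr (hpS.trans ⟨n₁, by rw [hSdef]⟩)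
        have h1 : a * ((b * ℓ₂ : ℕ) : ℤ) ≡ k * Δ [ZMOD p] := Int.ModEq.of_dvd hpS' hfreqS
        have h2 : (p : ℤ) ∣ k * Δ := by
          have h3 : (p : ℤ) ∣ a * ((b * ℓ₂ : ℕ) : ℤ) := hpa.mul_right _
          have := (Int.modEq_iff_dvd.mp h1)
          -- `p ∣ kΔ - a bℓ₂` and `p ∣ a bℓ₂`
          have h4 : k * Δ = (k * Δ - a * ((b * ℓ₂ : ℕ) : ℤ)) + a * ((b * ℓ₂ : ℕ) : ℤ) := by ring
          rw [h4]; exact dvd_add this h3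
        exact hprime_dvd p hp k Δ hkp h2
      have hY₁ : ¬ ((ℓ₁ : ℤ) ∣ a) := by
        intro h
        have h1 : (ℓ₁ : ℤ) ∣ Δ := hΔdvd ℓ₁ hp₁ (dvd_mul_right _ _) hℓ₁k h
        -- `ℓ₁ ∣ Y ℓ₂`
        have h2 : (ℓ₁ : ℤ) ∣ Y * ℓ₂ := by
          have : Y * ℓ₂ = Δ + (d - d') * (ℓ₁ * ℓ₁' : ℕ) := by rw [hΔ]; ring
          rw [this]; refine dvd_add h1 ?_
          push_cast; exact Dvd.intro (↑ℓ₁' * (d - d')) (by ring)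
        have h3 : (ℓ₁ : ℤ) ∣ Y := by
          rw [mul_comm] at h2
          exact hprime_dvd ℓ₁ hp₁ ℓ₂ Y (hgcd_prime ℓ₁ ℓ₂ hp₁ hp₂ h12) h2
        -- `ℓ₁ ∣ d ℓ₁'`
        have h4 : (ℓ₁ : ℤ) ∣ d * ℓ₁' := by
          have : d * ℓ₁' = Y + d' * ℓ₁ := by rw [hY]; ring
          rw [this]; exact dvd_add h3 (Dvd.intro_left d' rfl)
        have h5 : (ℓ₁ : ℤ) ∣ d := by
          rw [mul_comm] at h4
          exact hprime_dvd ℓ₁ hp₁ ℓ₁' d (hgcd_prime ℓ₁ ℓ₁' hp₁ hp₁' hℓeq) h4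
        exact hℓ₁d h5
      have hY₂ : ¬ ((ℓ₁' : ℤ) ∣ a) := by
        intro h
        have h1 : (ℓ₁' : ℤ) ∣ Δ := hΔdvd ℓ₁' hp₁' (dvd_mul_left _ _) hℓ₁'k h
        have h2 : (ℓ₁' : ℤ) ∣ Y * ℓ₂ := by
          have : Y * ℓ₂ = Δ + (d - d') * (ℓ₁ * ℓ₁' : ℕ) := by rw [hΔ]; ring
          rw [this]; refine dvd_add h1 ?_
          push_cast; exact Dvd.intro (↑ℓ₁ * (d - d')) (by ring)
        have h3 : (ℓ₁' : ℤ) ∣ Y := by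
          rw [mul_comm] at h2
          exact hprime_dvd ℓ₁' hp₁' ℓ₂ Y (hgcd_prime ℓ₁' ℓ₂ hp₁' hp₂ h12') h2
        have h4 : (ℓ₁' : ℤ) ∣ d' * ℓ₁ := by
          have : d' * ℓ₁ = d * ℓ₁' - Y := by rw [hY]; ring
          rw [this]; exact dvd_sub (Dvd.intro_left d rfl) h3
        have h5 : (ℓ₁' : ℤ) ∣ d' := by
          rw [mul_comm] at h4
          exact hprime_dvd ℓ₁' hp₁' ℓ₁ d' (hgcd_prime ℓ₁' ℓ₁ hp₁' hp₁ (Ne.symm hℓeq)) h4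
        exact hℓ₁'d' h5
      have hcopa : Nat.Coprime a.natAbs (ℓ₁ * ℓ₁') := by
        refine Nat.Coprime.mul_right ?_ ?_
        · rw [Nat.coprime_comm, Nat.Prime.coprime_iff_not_dvd hp₁]
          exact fun h => hY₁ (Int.natCast_dvd.mpr h)
        · rw [Nat.coprime_comm, Nat.Prime.coprime_iff_not_dvd hp₁']
          exact fun h => hY₂ (Int.natCast_dvd.mpr h)
      have : Int.gcd a t₂ = 1 := by
        rw [Int.gcd_eq_natAbs, Int.natAbs_natCast]
        exact Nat.Coprime.coprime_dvd_right ht₂ hcopa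
      rw [this]; norm_num
  -- Step 7b: coprimality with `q`
  have hqcop : ∀ m : ℕ, m.Coprime b → m.Coprime d.natAbs → m.Coprime d'.natAbs → m.Coprime q := by
    intro m hmb hmd hmd'
    refine Nat.Coprime.coprime_dvd_right (Nat.lcm_dvd_mul _ _) ?_
    exact Nat.Coprime.mul_right (Nat.Coprime.mul_right hmb hmd) (Nat.Coprime.mul_right hmb hmd')
  have hn₁d : n₁.Coprime d.natAbs := by
    rw [Int.gcd_eq_natAbs, Int.natAbs_natCast] at hdn₁; exact Nat.Coprime.symm hdn₁
  have hn₁d' : n₁.Coprime d'.natAbs := by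
    rw [Int.gcd_eq_natAbs, Int.natAbs_natCast] at hd'n₁; exact Nat.Coprime.symm hd'n₁
  have hℓ₁d_nat : ℓ₁.Coprime d.natAbs :=
    (Nat.Prime.coprime_iff_not_dvd hp₁).mpr (fun h => hℓ₁d (Int.natCast_dvd.mpr h))
  have hℓ₁'d'_nat : ℓ₁'.Coprime d'.natAbs :=
    (Nat.Prime.coprime_iff_not_dvd hp₁').mpr (fun h => hℓ₁'d' (Int.natCast_dvd.mpr h))
  have hn₁q : n₁.Coprime q := hqcop n₁ hn₁b hn₁d hn₁d'
  have hℓ₂q : ℓ₂.Coprime q := hqcop ℓ₂ hℓ₂b (Nat.Coprime.coprime_mul_left_right hℓq₁)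
    (Nat.Coprime.coprime_mul_left_right hℓq₂)
  -- Step 7c: the class sums (four cases for the factorisation `S = s₁ (t₂ n₁)`)
  set B' : ℝ := 2 * (((N₂ : ℝ) - N₁ + 3) * (Int.gcd Δ n₁ : ℝ) / n₁ +
    (S.divisors.card : ℝ) * Real.sqrt (S : ℝ) * lam * Real.sqrt (Int.gcd Δ n₁ : ℝ) *
      (1 + Real.log (S : ℝ))) with hB'
  have hcases : ∃ s₁ t₂ : ℕ, S = s₁ * (t₂ * n₁) ∧ 0 < s₁ ∧ 0 < t₂ ∧ s₁.Coprime (t₂ * n₁) ∧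
      t₂.Coprime n₁ ∧ q.Coprime (t₂ * n₁) ∧ s₁ ∣ q ∧ t₂ ∣ ℓ₁ * ℓ₁' := by
    by_cases h1 : (ℓ₁ : ℤ) ∣ d'
    · -- then `ℓ₁ ≠ ℓ₁'`
      have hne : ℓ₁ ≠ ℓ₁' := fun h => hℓ₁'d' (h ▸ h1)
      have h1q : ℓ₁ ∣ q := ((Int.natCast_dvd.mp h1).trans (dvd_mul_left _ b)).trans
        (Nat.dvd_lcm_right _ _)
      by_cases h2 : (ℓ₁' : ℤ) ∣ d
      · have h2q : ℓ₁' ∣ q := ((Int.natCast_dvd.mp h2).trans (dvd_mul_left _ b)).trans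
          (Nat.dvd_lcm_left _ _)
        refine ⟨ℓ₁ * ℓ₁', 1, by rw [hSdef]; ring, ht, zero_lt_one, ?_, Nat.coprime_one_left _,
          ?_, ?_, one_dvd _⟩
        · rw [one_mul]; exact htn₁
        · rw [one_mul]; exact hn₁q.symm
        · exact Nat.Coprime.mul_dvd_of_dvd_of_dvd ((Nat.coprime_primes hp₁ hp₁').mpr hne) h1q h2q
      · have hℓ₁'d_nat : ℓ₁'.Coprime d.natAbs :=
          (Nat.Prime.coprime_iff_not_dvd hp₁').mpr (fun h => h2 (Int.natCast_dvd.mpr h))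
        have hℓ₁'q : ℓ₁'.Coprime q := hqcop ℓ₁' hℓ₁'b hℓ₁'d_nat hℓ₁'d'_nat
        refine ⟨ℓ₁, ℓ₁', by rw [hSdef]; ring, hp₁.pos, hp₁'.pos, ?_, hn₁ℓ₁'.symm, ?_, h1q,
          dvd_mul_left _ _⟩
        · exact Nat.Coprime.mul_right ((Nat.coprime_primes hp₁ hp₁').mpr hne) hn₁ℓ₁.symm
        · exact (Nat.Coprime.mul_left hℓ₁'q hn₁q).symm
    · have hℓ₁d'_nat : ℓ₁.Coprime d'.natAbs :=
        (Nat.Prime.coprime_iff_not_dvd hp₁).mpr (fun h => h1 (Int.natCast_dvd.mpr h))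
      have hℓ₁q : ℓ₁.Coprime q := hqcop ℓ₁ hℓ₁b hℓ₁d_nat hℓ₁d'_nat
      by_cases h2 : (ℓ₁' : ℤ) ∣ d
      · have hne : ℓ₁ ≠ ℓ₁' := fun h => hℓ₁d (h ▸ h2)
        have h2q : ℓ₁' ∣ q := ((Int.natCast_dvd.mp h2).trans (dvd_mul_left _ b)).trans
          (Nat.dvd_lcm_left _ _)
        refine ⟨ℓ₁', ℓ₁, by rw [hSdef]; ring, hp₁'.pos, hp₁.pos, ?_, hn₁ℓ₁.symm, ?_, h2q,
          dvd_mul_right _ _⟩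
        · exact Nat.Coprime.mul_right ((Nat.coprime_primes hp₁' hp₁).mpr (Ne.symm hne))
            hn₁ℓ₁'.symm
        · exact (Nat.Coprime.mul_left hℓ₁q hn₁q).symm
      · have hℓ₁'d_nat : ℓ₁'.Coprime d.natAbs :=
          (Nat.Prime.coprime_iff_not_dvd hp₁').mpr (fun h => h2 (Int.natCast_dvd.mpr h))
        have hℓ₁'q : ℓ₁'.Coprime q := hqcop ℓ₁' hℓ₁'b hℓ₁'d_nat hℓ₁'d'_nat
        refine ⟨1, ℓ₁ * ℓ₁', by rw [hSdef]; ring, zero_lt_one, ht, Nat.coprime_one_left _, htn₁,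
          ?_, one_dvd _, dvd_rfl⟩
        exact (Nat.Coprime.mul_left (Nat.Coprime.mul_left hℓ₁q hℓ₁'q) hn₁q).symm
  obtain ⟨s₁, t₂, hSfac, hs₁, ht₂, hcop12, htn, hqs, hs₁q, ht₂dvd⟩ := hcases
  have hclass : ∀ y₁ y₂ : ℤ, y₁ ≤ y₂ → ((y₂ - y₁ : ℤ) : ℝ) ≤ (N₂ : ℝ) - N₁ →
      ‖∑ x ∈ (Finset.Ioc y₁ y₂).filter (fun x : ℤ =>
          x ≡ (n₀ : ℤ) [ZMOD q] ∧ (Int.gcd x S = 1 ∧ Int.gcd x ℓ₂ = 1)), g x‖ ≤ B' := by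
    intro y₁ y₂ hy hyR
    simp only [hg, hB']
    exact kfw_class_sum_le hSfac rfl hs₁ ht₂ hn₁ hcop12 htn hq hqs hs₁q hp₂ hℓ₂q haΔ hlam1
      (hat' t₂ ht₂dvd ht₂) (n₀ : ℤ) y₁ y₂ hy hyR
  -- Step 7d: Abel summation against the twist
  have hB'0 : 0 ≤ B' := by
    have h1 : 0 ≤ (N₂ : ℝ) - N₁ + 3 := by
      have : (N₁ : ℝ) ≤ N₂ := by exact_mod_cast hN
      linarith
    have h2 : 0 ≤ 1 + Real.log (S : ℝ) := by
      have := Real.log_nonneg (show (1 : ℝ) ≤ S by exact_mod_cast hS0); linarith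
    have h3 : 0 ≤ lam := le_trans zero_le_one hlam1
    have hA : 0 ≤ ((N₂ : ℝ) - N₁ + 3) * (Int.gcd Δ n₁ : ℝ) / n₁ :=
      div_nonneg (mul_nonneg h1 (Nat.cast_nonneg _)) (Nat.cast_nonneg _)
    have hBB : 0 ≤ (S.divisors.card : ℝ) * Real.sqrt (S : ℝ) * lam *
        Real.sqrt (Int.gcd Δ n₁ : ℝ) * (1 + Real.log (S : ℝ)) :=
      mul_nonneg (mul_nonneg (mul_nonneg (mul_nonneg (Nat.cast_nonneg _) (Real.sqrt_nonneg _))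
        h3) (Real.sqrt_nonneg _)) h2
    rw [hB']; linarith
  have hx₁x₂ : x₁ < x₂ := by
    have := (Finset.mem_Ioc.mp (Finset.mem_filter.mp hn₀mem).1)
    omega
  obtain ⟨K, hK⟩ : ∃ K : ℕ, x₂ = x₁ + K := ⟨(x₂ - x₁).toNat, by omega⟩
  have hK1 : 1 ≤ K := by omega
  rw [hK]
  set φ : ℤ → ℝ := fun x => 2 * Real.pi * |θ| * (1 / (x : ℝ)) with hφ
  have hf1 : ∀ x : ℤ, ‖f x‖ ≤ 1 := by
    intro x
    simp only [hf]
    have h : 2 * (Real.pi : ℂ) * Complex.I * ((θ : ℂ) / (x : ℂ)) =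
        (((2 * Real.pi * (θ / (x : ℝ))) : ℝ) : ℂ) * Complex.I := by push_cast; ring
    rw [h, Complex.norm_exp_ofReal_mul_I]
  have hvar : ∀ x : ℤ, x₁ < x → ‖f (x + 1) - f x‖ ≤ φ x - φ (x + 1) := by
    intro x hx
    have hx0 : 0 < x := by omega
    simp only [hf, hφ]
    have h := kfw_twist_variation θ hx0
    have e1 : (((x + 1 : ℤ)) : ℂ) = ((x : ℂ)) + 1 := by push_cast; ring
    have e2 : (((x + 1 : ℤ)) : ℝ) = ((x : ℝ)) + 1 := by push_cast; ring
    rw [e2]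
    calc ‖Complex.exp (2 * Real.pi * Complex.I * ((θ : ℂ) / ((x + 1 : ℤ) : ℂ))) -
          Complex.exp (2 * Real.pi * Complex.I * ((θ : ℂ) / (x : ℂ)))‖
        ≤ 2 * Real.pi * |θ| * (1 / (x : ℝ) - 1 / ((x : ℝ) + 1)) := h
      _ = 2 * Real.pi * |θ| * (1 / (x : ℝ)) - 2 * Real.pi * |θ| * (1 / ((x : ℝ) + 1)) := by ring
  have hpartial : ∀ kk : ℕ, kk ≤ K → ‖∑ x ∈ (Finset.Ioc x₁ (x₁ + kk)).filter (fun x : ℤ =>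
      x ≡ (n₀ : ℤ) [ZMOD q] ∧ (Int.gcd x S = 1 ∧ Int.gcd x ℓ₂ = 1)), g x‖ ≤ B' := by
    intro kk hkk
    refine hclass x₁ (x₁ + kk) (by omega) ?_
    have h1 : (x₁ + kk - x₁ : ℤ) = (kk : ℤ) := by ring
    rw [h1, Int.cast_natCast]
    have h2 : (kk : ℝ) ≤ K := by exact_mod_cast hkk
    have hx₂r : (x₂ : ℝ) ≤ N₂ := by exact_mod_cast hx₂
    have hx₁r : (N₁ : ℝ) ≤ x₁ := by exact_mod_cast hx₁
    have hKr : (x₂ : ℝ) = (x₁ : ℝ) + K := by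
      have := congrArg (fun z : ℤ => (z : ℝ)) hK
      simpa using this
    linarith
  have habel := kfw_abel_bound x₁ hK1 (fun x : ℤ =>
      x ≡ (n₀ : ℤ) [ZMOD q] ∧ (Int.gcd x S = 1 ∧ Int.gcd x ℓ₂ = 1)) g f φ hB'0 hpartial hf1 hvar
  refine habel.trans ?_
  -- Step 7e: `B' (1 + φ(x₁+1) - φ(x₁+K)) ≤ RHS = B' (1 + 2π|k||Y|/(bS(N₁+1)))`
  have hφK : 0 ≤ φ (x₁ + K) := by
    simp only [hφ]
    have hxK : (0 : ℝ) ≤ ((x₁ + K : ℤ) : ℝ) := by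
      have : (0 : ℤ) ≤ x₁ + K := by omega
      exact_mod_cast this
    exact mul_nonneg (mul_nonneg (mul_nonneg (by norm_num) Real.pi_pos.le) (abs_nonneg _))
      (one_div_nonneg.mpr hxK)
  have hb0r : (0 : ℝ) < b := by exact_mod_cast hb
  have hS0r : (0 : ℝ) < (S : ℝ) := by exact_mod_cast hS0
  have hbS0 : (0 : ℝ) < (b : ℝ) * S := mul_pos hb0r hS0r
  have hθabs : |θ| = |(k : ℝ)| * |(Y : ℝ)| / ((b : ℝ) * S) := by
    rw [hθ, abs_div, abs_of_pos hbS0]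
    congr 1
    rw [abs_neg, abs_mul]
  have hφ1 : φ (x₁ + 1) ≤ 2 * Real.pi * |(k : ℝ)| * |(Y : ℝ)| / ((b : ℝ) * S * ((N₁ : ℝ) + 1)) := by
    simp only [hφ]
    rw [hθabs]
    have hN1 : (0 : ℝ) < (N₁ : ℝ) + 1 := by
      have : (0 : ℝ) ≤ (N₁ : ℝ) := Nat.cast_nonneg _
      linarith
    have hx1 : (N₁ : ℝ) + 1 ≤ ((x₁ + 1 : ℤ) : ℝ) := by
      rw [Int.cast_add, Int.cast_one]
      have := (show (N₁ : ℝ) ≤ x₁ by exact_mod_cast hx₁)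
      linarith
    have h1 : 1 / (((x₁ + 1 : ℤ)) : ℝ) ≤ 1 / ((N₁ : ℝ) + 1) :=
      one_div_le_one_div_of_le hN1 hx1
    have h2 : 0 ≤ 2 * Real.pi * (|(k : ℝ)| * |(Y : ℝ)| / ((b : ℝ) * S)) :=
      mul_nonneg (mul_nonneg (by norm_num) Real.pi_pos.le)
        (div_nonneg (mul_nonneg (abs_nonneg _) (abs_nonneg _)) hbS0.le)
    calc 2 * Real.pi * (|(k : ℝ)| * |(Y : ℝ)| / ((b : ℝ) * S)) * (1 / ((x₁ + 1 : ℤ) : ℝ))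
        ≤ 2 * Real.pi * (|(k : ℝ)| * |(Y : ℝ)| / ((b : ℝ) * S)) * (1 / ((N₁ : ℝ) + 1)) :=
          mul_le_mul_of_nonneg_left h1 h2
      _ = 2 * Real.pi * |(k : ℝ)| * |(Y : ℝ)| / ((b : ℝ) * S * ((N₁ : ℝ) + 1)) := by
          field_simp
  have hfin : B' * (1 + (φ (x₁ + 1) - φ (x₁ + K))) ≤ RHS := by
    have h1 : 1 + (φ (x₁ + 1) - φ (x₁ + K)) ≤
        1 + 2 * Real.pi * |(k : ℝ)| * |(Y : ℝ)| / ((b : ℝ) * S * ((N₁ : ℝ) + 1)) := by linarith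
    calc B' * (1 + (φ (x₁ + 1) - φ (x₁ + K)))
        ≤ B' * (1 + 2 * Real.pi * |(k : ℝ)| * |(Y : ℝ)| / ((b : ℝ) * S * ((N₁ : ℝ) + 1))) :=
          mul_le_mul_of_nonneg_left h1 hB'0
      _ = RHS := by rw [hRHS, hB']; ring
  exact hfin

end Literature.NumberTheory.LFunctions

end
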